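import Summits.Ventures.HSemireg.Pad4TowerLinePhaseRigidityParity

/-!
# Pad4Tower ∕ LinePhaseRigidity — Part J (1∕2) THE UNIT NUCLEUS BELOW TWELVE: `Fin 4` tag bookkeeping, `shiftN_by`, the unit hub ∕ unit sibling ∕ two-sibling clauses in the model, `raise3`∕`raise2`, `n_three_units_antipodal`, `unitP_antipodal_absent`, the top-3 package, `w_of`, `z_absent`
# (HSemireg support file; PT-PORT-2 (a3), tree copy of control's crux workfile)

Crux of record: `Summit.HodgeConjecture.HodgeConjecture.Theses.EightfoldBlochSeeds.BlochSeedDiscOne` (= `HasHyperbolicBlochSeed 4 1`, item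
stmt-HodgeConjecture-18881; skeleton `Cruxes/BlochSeedDiscOne/Lines/birth.lean` 814a6a70c14e831a, STUB R `stub_rung_pad4_seedAt`, UNTOUCHED).
Nothing in this file proves HC, HC_AV, HC_CM, H2, item 18881, (T₈) or (T₁₀); census-neutral (no SAT∕UNSAT row is added or changed). Statements about
the typed FIRST-ORDER static game on the LINE alphabet of the PAD-4 design tower (`RuleDMu4Closed`, `XPlusClosed`, `G1Closed` of record) — H₁-static
letter DESIGNS, not sheaves, monads or seeds; HC_CM is a displayed binder of the ladder only, unused here.

PROVENANCE. TREE COPY — statements AND proofs verbatim; new are only the namespace `Summit.Ventures.HSemireg.Pad4Tower.LinePhaseRigidity`, this module docstring, the module boundary, the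
`open` of the tree toolkit namespace `…Pad4Tower.LineInertia` (= the workfile's Part A), one-line docstrings where the gate requires them, and these dedups
to the tree (the one the key allows: Part J's `fin4_add_two_ne : ∀ k : Fin 4, k + 2 ≠ k` is NOT re-declared — its uses call the toolkit's identical `LineInertia.add_two_ne` —
and, of the same kind, the `decide` fact `fin4_add_two_two : ∀ k : Fin 4, k + 2 + 2 = k` is NOT declared — it duplicates a foreign-summit tree lemma the gate flags
(`CardyFormulaZ2 … CSQuad.f4_22`), so its one use here (and the two in `…Shape`) carry the `decide` term inline)
of Part J, first half (through `z_absent`; the workfile's `namespace LineModel` is closed at the module boundary and re-opened in `…Nucleus2`) of the crux workfile `Cruxes/BlochSeedDiscOne/LinePhaseRigidity.lean` v1.9 (author plan-lens-HodgeAV-control g9; crux commit f5c30e1c3066, sha16 f0ad6d2122a71d9c; critic plates idea-crit-6 g15 PASS). Filed in the tree on plan-lens-HodgeAV-control g10's KEY (a3) (bus l.10147: «Parts G–L up to `oddFCFreeLine_of_lt_twelve`,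
`not_oddFCFreeLine_twelve`, `fcShapeLine_of_lt_twelve` → tree, so that `DiamondLevelLaws.OddLineFree h` (∀ h < 12) is a tree theorem and the displayed
hypothesis of `oddThreshold_iff_lineNest` is discharged by name» — control's wording; `DiamondLevelLaws.OddLineFree` ∕ `oddThreshold_iff_lineNest` are declarations of the
crux workfile `Cruxes/BlochSeedDiscOne/DiamondLevelLaws.lean`, NOT of this chain) by hsemireg-phasetorus-typer-1 g3 (v3 docstring∕dedup hygiene by typer-1 g5). Module set of (a3), each importing the previous, on top of
(a2)'s `Pad4TowerLinePhaseRigidityGap`: `Pad4TowerLinePhaseRigidityTags` (Part G) → `…Parity` (Parts H, I) → `…Nucleus1` (Part J, first half) → `…Nucleus2` (Part J, second half: `oddFCFreeLine_of_lt_twelve`, `oddLineThresholdLaw_holds`) → `…PhaseType` (Part K) → `…Shape` (Part L: `fcShapeLine_of_lt_twelve`). 0 sorry, 0 named facts, no instance ∕ notation ∕ set_option ∕ native_decide; docstring on every declaration.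

CONTENT. `one_le_of_eq_one`∕`_two`, `fin4_add_ne_of_ne_zero`, `fin4_add_neg_ne_of_ne_zero`, `fin4_add_neg_ne_add`, `fin4_add_add_neg` (tag bookkeeping; `fin4_add_two_ne` = toolkit `add_two_ne`); in `namespace LineModel` (all with `h < 12`): `shiftN_by`, `unit_hub`, `unit_sibling`, `two_sibling`, `raise3`, `raise2`, `n_three_units_antipodal`, `unitP_antipodal_absent`, `top3_sibling4`, `top3_N3`, `top3_package`, `w_of`, `z_absent`.
-/

namespace Summit.Ventures.HSemireg.Pad4Tower.LinePhaseRigidity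

open Finset Summit.Ventures.HSemireg.Pad4Tower Summit.Ventures.HSemireg.LinePhaseTorus Summit.Ventures.HSemireg.Pad4Tower.LineInertia

/-! ## Part J (first half) — THE UNIT NUCLEUS BELOW TWELVE: the model lemmas up to `z_absent`

STATUS. Part J of the crux workfile proves `AbstractOddFree h` for every `h < 12` and hence `OddLineThresholdLaw`; its tree port is split in two: THIS
module carries the lemmas up to `z_absent`, and the concluding theorems (`two_units3_absent`, `units4_odd_absent`, `abstractOddUnitNucleusFree_of_lt_twelve`,
`abstractOddFree_of_lt_twelve`, `oddFCFreeLine_of_lt_twelve`, `oddLineThresholdLaw_holds`) are in the NEXT chain module `…Nucleus2` — nothing in this module proves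
`AbstractOddFree h` or `OddLineThresholdLaw`.  The workfile's account of Part J:

Part I left, below twelve, only the unit nucleus on the `P` level: odd unit cells and the `(2;1,1,1)` cells.  Up to the slot and tag
symmetries of the model these are three families — `P[1_k,1_k,1_k,1_{k+t}]` (`t` odd), `P[1_k,1_m,1_{k+2},1_*]` (`m ∉ {k,k+2}`) and
`P[1_k,1_k,1_k,2_{k+t}]` (`t ≠ 0`) — and each is refuted below by an explicit chain of RD-P ∕ RD-N2 ∕ `X+` steps whose every
alternative landing is dead by the PROVED laws of Parts E–I (`p3_gap_two`, `p_ceiling_absent`, `p3_tags`, `n3_tags`, `fcN_tags_const`)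
— the chains were read off the unit-propagation refutation of the kernel-augmented clause set at `h = 10` (crux-workfile scripts `kern10.py`, `upchain.py`:
all six nucleus orbits are UNSAT at conflict limit 0 once the proved laws are added as clauses) and then proved uniformly for `h < 12`.
Consequently (in `…Nucleus2`) `(OL_h)` holds for EVERY `h < 12` in the kernel and the typed threshold law `OddLineThresholdLaw` is a theorem outright there. -/

/-- `one_le_of_eq_one` (Part J; tree copy, statement verbatim). -/
theorem one_le_of_eq_one {n : ℕ} (e : n = 1) : 1 ≤ n := by omega
/-- `one_le_of_eq_two` (Part J; tree copy, statement verbatim). -/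
theorem one_le_of_eq_two {n : ℕ} (e : n = 2) : 1 ≤ n := by omega
/-- `fin4_add_ne_of_ne_zero` (Part J; tree copy, statement verbatim). -/
theorem fin4_add_ne_of_ne_zero : ∀ k t : Fin 4, t ≠ 0 → k + t ≠ k := by decide
/-- `fin4_add_neg_ne_of_ne_zero` (Part J; tree copy, statement verbatim). -/
theorem fin4_add_neg_ne_of_ne_zero : ∀ k t : Fin 4, t ≠ 0 → k + -t ≠ k := by decide
/-- `fin4_add_neg_ne_add` (Part J; tree copy, statement verbatim). -/
theorem fin4_add_neg_ne_add : ∀ k t : Fin 4, t + t ≠ 0 → k + -t ≠ k + t := by decide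
/-- `fin4_add_add_neg` (Part J; tree copy, statement verbatim). -/
theorem fin4_add_add_neg : ∀ k t : Fin 4, k + t + -t = k := by decide

namespace LineModel

variable {h : ℤ} {vN vP : ACell → Prop}

/-- the tag shift by any amount on the `N` level. -/
theorem shiftN_by (M : LineModel h vN vP) {X : ACell} (hX : vN X) (s : Fin 4) : vN (fun i => ((X i).1, (X i).2 + s)) := by
  have h1 := M.shiftN _ hX
  have h2 := M.shiftN _ h1
  have h3 := M.shiftN _ h2
  have h4 := M.shiftN _ h3
  have e1 : X.shift = fun i => ((X i).1, (X i).2 + 3) := rfl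
  have e2 : X.shift.shift = fun i => ((X i).1, (X i).2 + 2) := by
    funext i; simp only [ACell.shift]; refine Prod.ext rfl ?_; show (X i).2 + 3 + 3 = (X i).2 + 2
    have : ∀ k : Fin 4, k + 3 + 3 = k + 2 := by decide
    exact this _
  have e3 : X.shift.shift.shift = fun i => ((X i).1, (X i).2 + 1) := by
    funext i; simp only [ACell.shift]; refine Prod.ext rfl ?_; show (X i).2 + 3 + 3 + 3 = (X i).2 + 1
    have : ∀ k : Fin 4, k + 3 + 3 + 3 = k + 1 := by decide
    exact this _
  have e4 : X.shift.shift.shift.shift = fun i => ((X i).1, (X i).2 + 0) := by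
    funext i; simp only [ACell.shift]; refine Prod.ext rfl ?_; show (X i).2 + 3 + 3 + 3 + 3 = (X i).2 + 0
    have : ∀ k : Fin 4, k + 3 + 3 + 3 + 3 = k + 0 := by decide
    exact this _
  fin_cases s
  · rw [e4] at h4; exact h4
  · rw [e3] at h3; exact h3
  · rw [e2] at h2; exact h2
  · rw [e1] at h1; exact h1

/-- the hub of a unit letter: lowering a unit letter (RD-P) lands on the apex, so `X[s ≔ apex]` is present on the `N` level. -/
theorem unit_hub (M : LineModel h vN vP) {X : ACell} (hX : vP X) {s : Fin 4} (hs : (X s).1 = 1) (k : Fin 4) :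
    vN (Function.update X s (0, k)) := by
  obtain ⟨c', hc', hN⟩ := M.rdP X hX s (by rw [hs])
  rw [hs] at hc'
  have h0 : c' = 0 := by omega
  subst h0
  have := M.apexN _ hN s k (by rw [Function.update_self])
  rwa [Function.update_idem] at this

/-- **UNIT SIBLING EXCLUSION (abstract form of Part B, PROVED)**: a `P`-cell with an apex and a unit letter `(1,k)` at `s` excludes every
unit sibling `X[s ≔ (1,k'')]`, `k'' ≠ k` (`X+` with the unit hub; no shallower letter, no companion). -/
theorem unit_sibling (M : LineModel h vN vP) {X : ACell} (hX : vP X) {s f : Fin 4} (hfs : f ≠ s) (hf : (X f).1 = 0)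
    (hs : (X s).1 = 1) {k'' : Fin 4} (hk : k'' ≠ (X s).2) : ¬ vP (Function.update X s (1, k'')) := by
  intro hS
  exact M.xplus X hX s f hfs (by rw [hs]) hf (M.unit_hub hX hs 0)
    (fun c' h1 h2 => absurd h2 (by rw [hs]; omega)) 1 k'' hk le_rfl hS (fun e' h1 h2 => absurd h2 (by omega))

/-- **CHARGE-2 SIBLING EXCLUSION (PROVED)**: a `P`-cell with an apex and a charge-2 letter `(2,k)` at `s` whose unit shadow `X[s ≔ (1,k)]`
is absent on `N` excludes every unit sibling `X[s ≔ (1,k'')]`, `k'' ≠ k` (the hub is then the RD-P landing; `X+`). -/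
theorem two_sibling (M : LineModel h vN vP) {X : ACell} (hX : vP X) {s f : Fin 4} (hfs : f ≠ s) (hf : (X f).1 = 0)
    (hs : (X s).1 = 2) (hsh : ¬ vN (Function.update X s (1, (X s).2))) {k'' : Fin 4} (hk : k'' ≠ (X s).2) :
    ¬ vP (Function.update X s (1, k'')) := by
  intro hS
  obtain ⟨c', hc', hN⟩ := M.rdP X hX s (by rw [hs]; omega)
  rw [hs] at hc'
  have h0 : c' = 0 := by
    rcases (by omega : c' = 0 ∨ c' = 1) with h0 | h1
    · exact h0
    · exact absurd (h1 ▸ hN) hsh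
  subst h0
  have hub := M.apexN _ hN s 0 (by rw [Function.update_self])
  rw [Function.update_idem] at hub
  exact M.xplus X hX s f hfs (by rw [hs]; omega) hf hub
    (fun c' h1 h2 => by
      have : c' = 1 := by rw [hs] at h2; omega
      subst this; exact hsh) 1 k'' hk le_rfl hS (fun e' h1 h2 => absurd h2 (by omega))

/-- RD-N2 on a `3`-charged `N`-cell below twelve: the raised letter lands at charge `≤ 3` (`p3_gap_two`), and at charge `3` only if the two
other charged tags are equal (`p3_tags`). -/
theorem raise3 (M : LineModel h vN vP) (hh : h < 12) {Y : ACell} (hY : vN Y) {g a b f : Fin 4} (hga : g ≠ a) (hgb : g ≠ b)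
    (hgf : g ≠ f) (hab : a ≠ b) (haf : a ≠ f) (hbf : b ≠ f) (hg : 1 ≤ (Y g).1) (ha : 1 ≤ (Y a).1) (hb : 1 ≤ (Y b).1)
    (hf : (Y f).1 = 0) :
    ∃ c' : ℕ, (Y g).1 < c' ∧ c' ≤ 3 ∧ vP (Function.update Y g (c', (Y g).2)) ∧ (c' = 3 → (Y a).2 = (Y b).2) := by
  obtain ⟨c', hlt, -, hP⟩ := M.rdN2 Y hY g a hga hg ha
  have ha' : 1 ≤ (Function.update Y g (c', (Y g).2) a).1 := by rw [Function.update_of_ne hga.symm]; exact ha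
  have hb' : 1 ≤ (Function.update Y g (c', (Y g).2) b).1 := by rw [Function.update_of_ne hgb.symm]; exact hb
  have hf' : (Function.update Y g (c', (Y g).2) f).1 = 0 := by rw [Function.update_of_ne hgf.symm]; exact hf
  have hgc : (Function.update Y g (c', (Y g).2) g).1 = c' := by rw [Function.update_self]
  have hg' : 1 ≤ (Function.update Y g (c', (Y g).2) g).1 := by rw [hgc]; omega
  have gap := M.p3_gap_two hP hga hgb hab hg' ha' hb'
  rw [hgc] at gap
  refine ⟨c', hlt, by omega, hP, fun h3 => ?_⟩
  have := M.p3_tags hga hgb hgf hab haf hbf hP hg' (by rw [hgc]; omega) ha' hb' hf'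
  rwa [Function.update_of_ne hga.symm, Function.update_of_ne hgb.symm] at this

/-- RD-N2 on an `N`-cell with a second charged letter, below twelve: the raised letter lands at charge `≤ 4` (`p_ceiling_absent`). -/
theorem raise2 (M : LineModel h vN vP) (hh : h < 12) {Y : ACell} (hY : vN Y) {g b : Fin 4} (hgb : g ≠ b)
    (hg : 1 ≤ (Y g).1) (hb : 1 ≤ (Y b).1) :
    ∃ c' : ℕ, (Y g).1 < c' ∧ c' ≤ 4 ∧ vP (Function.update Y g (c', (Y g).2)) := by
  obtain ⟨c', hlt, -, hP⟩ := M.rdN2 Y hY g b hgb hg hb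
  refine ⟨c', hlt, ?_, hP⟩
  by_contra hc
  have hgc : (Function.update Y g (c', (Y g).2) g).1 = c' := by rw [Function.update_self]
  exact M.p_ceiling_absent hP hgb (by rw [hgc]; omega) (by rw [Function.update_of_ne hgb.symm]; exact hb) (by rw [hgc]; omega)

/-- **THREE UNIT TAGS WITH AN ANTIPODAL PAIR ARE ABSENT ON `N` below twelve (PROVED).** `N[1_k, 1_m, 1_{k+2}, apex]` with
`m ∉ {k, k+2}`: both antipodal letters are raised to charge exactly `2` (charge `3` is `p3_tags`-dead since the two remaining tags differ);
the second raised cell, slots swapped and tags shifted by `2`, is the unit sibling `m+2 ≠ m` of the first — excluded by `unit_sibling`. -/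
theorem n_three_units_antipodal (M : LineModel h vN vP) (hh : h < 12) {Y : ACell} (hY : vN Y) {a b c f : Fin 4}
    (hab : a ≠ b) (hac : a ≠ c) (haf : a ≠ f) (hbc : b ≠ c) (hbf : b ≠ f) (hcf : c ≠ f) {k m : Fin 4}
    (ha : Y a = (1, k)) (hb : Y b = (1, m)) (hc : Y c = (1, k + 2)) (hf : (Y f).1 = 0) (hmk : m ≠ k) (hmk2 : m ≠ k + 2) :
    False := by
  have ha1 : (Y a).1 = 1 := by rw [ha]
  have hb1 : (Y b).1 = 1 := by rw [hb]
  have hc1 : (Y c).1 = 1 := by rw [hc]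
  -- raise `a` to exactly `2`
  obtain ⟨c₁, h1lt, h1le, hV0, h1t⟩ := M.raise3 hh hY hab hac haf hbc hbf hcf (one_le_of_eq_one ha1) (one_le_of_eq_one hb1)
    (one_le_of_eq_one hc1) hf
  rw [ha1] at h1lt
  have hc₁ : c₁ = 2 := by
    rcases (by omega : c₁ = 2 ∨ c₁ = 3) with e | e
    · exact e
    · exfalso; have := h1t e; rw [hb, hc] at this; exact hmk2 this
  subst hc₁
  rw [show (Y a).2 = k by rw [ha]] at hV0
  -- raise `c` to exactly `2`
  obtain ⟨c₂, h2lt, h2le, hV2, h2t⟩ := M.raise3 hh hY hac.symm hbc.symm hcf hab haf hbf (one_le_of_eq_one hc1)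
    (one_le_of_eq_one ha1) (one_le_of_eq_one hb1) hf
  rw [hc1] at h2lt
  have hc₂ : c₂ = 2 := by
    rcases (by omega : c₂ = 2 ∨ c₂ = 3) with e | e
    · exact e
    · exfalso; have := h2t e; rw [ha, hb] at this; exact hmk this.symm
  subst hc₂
  rw [show (Y c).2 = k + 2 by rw [hc]] at hV2
  -- the second raised cell, swapped `a ↔ c` and shifted by `2`, is the `b`-sibling `(1, m+2)` of the first
  have hS := M.shiftP_by (M.permP _ hV2 (Equiv.swap a c)) 2
  have hT : vP (Function.update (Function.update Y a (2, k)) b (1, m + 2)) := by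
    refine M.congrP hS (fun i => ?_)
    dsimp only
    rcases fin4_cover hab hac haf hbc hbf hcf i with hi | hi | hi | hi <;> rw [hi]
    · left
      rw [Equiv.swap_apply_left, Function.update_self, Function.update_of_ne hab, Function.update_self]
      exact Prod.ext rfl ((by decide : ∀ k : Fin 4, k + 2 + 2 = k) k)
    · left
      rw [Equiv.swap_apply_of_ne_of_ne hab.symm hbc, Function.update_of_ne hbc, hb, Function.update_self]
    · left
      rw [Equiv.swap_apply_right, Function.update_of_ne hac, ha, Function.update_of_ne hbc.symm,
        Function.update_of_ne hac.symm, hc]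
    · right
      rw [Equiv.swap_apply_of_ne_of_ne haf.symm hcf.symm, Function.update_of_ne hcf.symm, Function.update_of_ne hbf.symm,
        Function.update_of_ne haf.symm]
      exact ⟨hf, hf⟩
  refine M.unit_sibling hV0 (s := b) (f := f) hbf.symm ?_ ?_ ?_ hT
  · rw [Function.update_of_ne haf.symm]; exact hf
  · rw [Function.update_of_ne hab.symm, hb]
  · rw [Function.update_of_ne hab.symm, hb]; exact add_two_ne m

/-- **THE ANTIPODAL-TYPE UNIT CELLS ARE ABSENT below twelve (PROVED)**: `P[1_k, 1_m, 1_{k+2}, 1_*]`, `m ∉ {k, k+2}` (lower the fourth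
letter; `n_three_units_antipodal`).  Covers the odd unit types `0012`, `0023` (and the even `0123`, `0112`). -/
theorem unitP_antipodal_absent (M : LineModel h vN vP) (hh : h < 12) {X : ACell} (hX : vP X) {a b c d : Fin 4}
    (hab : a ≠ b) (hac : a ≠ c) (had : a ≠ d) (hbc : b ≠ c) (hbd : b ≠ d) (hcd : c ≠ d)
    (ha1 : (X a).1 = 1) (hb1 : (X b).1 = 1) (hc1 : (X c).1 = 1) (hd1 : (X d).1 = 1)
    (hc2 : (X c).2 = (X a).2 + 2) (hb2 : (X b).2 ≠ (X a).2) (hb2' : (X b).2 ≠ (X a).2 + 2) : False := by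
  have hN := M.unit_hub hX hd1 0
  exact M.n_three_units_antipodal hh hN hab hac had hbc hbd hcd (k := (X a).2) (m := (X b).2)
    (by rw [Function.update_of_ne had]; exact Prod.ext ha1 rfl) (by rw [Function.update_of_ne hbd]; exact Prod.ext hb1 rfl)
    (by rw [Function.update_of_ne hcd]; exact Prod.ext hc1 hc2) (by rw [Function.update_self]) hb2 hb2'

/-- **TOP-THREE PACKAGE, step 1 (PROVED)**: from `W = P[3_k@g, unit@b, 1_k@c, *]`: `N30 = W[b ≔ apex]` is present (unit hub), its
RD-N2 raise of `g` is `Y = N30[g ≔ (4,k)]` (charge `5` is `p_ceiling_absent`-dead), and the unit siblings `Y[c ≔ (1,j)]`, `j ≠ k`, are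
excluded. -/
theorem top3_sibling4 (M : LineModel h vN vP) (hh : h < 12) {W : ACell} (hW : vP W) {g b c : Fin 4} (hgb : g ≠ b) (hgc : g ≠ c)
    (hbc : b ≠ c) {k : Fin 4} (hg : W g = (3, k)) (hb1 : (W b).1 = 1) (hc : W c = (1, k)) {j : Fin 4} (hj : j ≠ k) :
    ¬ vP (Function.update (Function.update (Function.update W b (0, 0)) g (4, k)) c (1, j)) := by
  have hN30 := M.unit_hub hW hb1 0
  have e_g : Function.update W b (0, 0) g = (3, k) := by rw [Function.update_of_ne hgb, hg]
  have e_c : Function.update W b (0, 0) c = (1, k) := by rw [Function.update_of_ne hbc.symm, hc]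
  obtain ⟨c₁, h1lt, h1le, hY⟩ := M.raise2 hh hN30 (g := g) (b := c) hgc (by rw [e_g]; omega) (one_le_of_eq_one (by rw [e_c]))
  rw [show (Function.update W b (0, 0) g).1 = 3 by rw [e_g]] at h1lt
  have hc₁ : c₁ = 4 := by omega
  subst hc₁
  rw [show (Function.update W b (0, 0) g).2 = k by rw [e_g]] at hY
  refine M.unit_sibling hY (s := c) (f := b) hbc ?_ ?_ ?_
  · rw [Function.update_of_ne hgb.symm, Function.update_self]
  · rw [Function.update_of_ne hgc.symm, e_c]
  · rw [Function.update_of_ne hgc.symm, e_c]; exact hj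

/-- **TOP-THREE PACKAGE, step 2 (PROVED)**: with `W` as above, `N[3_k@g, apex@b, 1_j@c, *]` (`j ≠ k`) is absent — its RD-N2 raise of `g`
would be an excluded sibling of step 1 (charge `5` being dead). -/
theorem top3_N3 (M : LineModel h vN vP) (hh : h < 12) {W : ACell} (hW : vP W) {g b c : Fin 4} (hgb : g ≠ b) (hgc : g ≠ c)
    (hbc : b ≠ c) {k : Fin 4} (hg : W g = (3, k)) (hb1 : (W b).1 = 1) (hc : W c = (1, k)) {j : Fin 4} (hj : j ≠ k) :
    ¬ vN (Function.update (Function.update W b (0, 0)) c (1, j)) := by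
  intro hN
  have e_g : Function.update (Function.update W b (0, 0)) c (1, j) g = (3, k) := by
    rw [Function.update_of_ne hgc, Function.update_of_ne hgb, hg]
  obtain ⟨c₂, h2lt, h2le, hP⟩ := M.raise2 hh hN (g := g) (b := c) hgc (by rw [e_g]; omega)
    (one_le_of_eq_one (by rw [Function.update_self]))
  rw [show (Function.update (Function.update W b (0, 0)) c (1, j) g).1 = 3 by rw [e_g]] at h2lt
  have hc₂ : c₂ = 4 := by omega
  subst hc₂
  rw [show (Function.update (Function.update W b (0, 0)) c (1, j) g).2 = k by rw [e_g], Function.update_comm hgc.symm] at hP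
  exact M.top3_sibling4 hh hW hgb hgc hbc hg hb1 hc hj hP

/-- **TOP-THREE PACKAGE, step 3 (PROVED)**: with `W` as above, every `P[3_k@g, unit@b, 1_j@c, *]` with `j ≠ k` is absent — its RD-P
service at the unit `b` would be the absent `N`-cell of step 2. -/
theorem top3_package (M : LineModel h vN vP) (hh : h < 12) {W : ACell} (hW : vP W) {g b c : Fin 4} (hgb : g ≠ b) (hgc : g ≠ c)
    (hbc : b ≠ c) {k : Fin 4} (hg : W g = (3, k)) (hb1 : (W b).1 = 1) (hc : W c = (1, k)) {j : Fin 4} (hj : j ≠ k) (m : Fin 4) :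
    ¬ vP (Function.update (Function.update W c (1, j)) b (1, m)) := by
  intro hZ
  have hub := M.unit_hub hZ (s := b) (by rw [Function.update_self]) 0
  rw [Function.update_idem, Function.update_comm hbc.symm] at hub
  exact M.top3_N3 hh hW hgb hgc hbc hg hb1 hc hj hub

/-- **THE `W`-STEP (PROVED)**: if `N000 = N[1_k@a,1_k@b,1_k@c, apex@d]` is present and the cell `P[apex@a, 2_k@b, 1_k@c, 1_k@d]` is absent,
then RD-N2 raises `a` to charge exactly `3`: `W = N000[a ≔ (3,k)]` is present (the charge-2 landing is that absent cell, slots permuted). -/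
theorem w_of (M : LineModel h vN vP) (hh : h < 12) {N0 : ACell} (hN0 : vN N0) {a b c d : Fin 4} (hab : a ≠ b) (hac : a ≠ c)
    (had : a ≠ d) (hbc : b ≠ c) (hbd : b ≠ d) (hcd : c ≠ d) {k : Fin 4} (ha : N0 a = (1, k)) (hb : N0 b = (1, k))
    (hc : N0 c = (1, k)) (hd : (N0 d).1 = 0) {V : ACell} (hVa : (V a).1 = 0) (hVb : V b = (2, k)) (hVc : V c = (1, k))
    (hVd : V d = (1, k)) (hV : ¬ vP V) : vP (Function.update N0 a (3, k)) := by
  have ha1 : (N0 a).1 = 1 := by rw [ha]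
  obtain ⟨c₁, h1lt, h1le, hP, -⟩ := M.raise3 hh hN0 hab hac had hbc hbd hcd (one_le_of_eq_one ha1)
    (one_le_of_eq_one (by rw [hb])) (one_le_of_eq_one (by rw [hc])) hd
  rw [ha1] at h1lt
  rw [show (N0 a).2 = k by rw [ha]] at hP
  rcases (by omega : c₁ = 2 ∨ c₁ = 3) with e | e
  · subst e
    exfalso
    apply hV
    have hS := M.permP _ (M.permP _ hP (Equiv.swap a b)) (Equiv.swap a d)
    refine M.congrP hS (fun i => ?_)
    rcases fin4_cover hab hac had hbc hbd hcd i with hi | hi | hi | hi <;> rw [hi]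
    · right
      rw [Equiv.swap_apply_left, Equiv.swap_apply_of_ne_of_ne had.symm hbd.symm, Function.update_of_ne had.symm]
      exact ⟨hd, hVa⟩
    · left
      rw [Equiv.swap_apply_of_ne_of_ne hab.symm hbd, Equiv.swap_apply_right, Function.update_self, hVb]
    · left
      rw [Equiv.swap_apply_of_ne_of_ne hac.symm hcd, Equiv.swap_apply_of_ne_of_ne hac.symm hbc.symm,
        Function.update_of_ne hac.symm, hc, hVc]
    · left
      rw [Equiv.swap_apply_right, Equiv.swap_apply_left, Function.update_of_ne hab.symm, hb, hVd]
  · subst e; exact hP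

/-- **THE `Z`-STEP (PROVED)**: with `W = P[3_k@a,1_k@b,1_k@c,apex@d]` present, every `Z = P[apex@a,1_k@b,1_k@c,3_{k+t}@d]` with `t ≠ 0` is
absent: swapped `a ↔ d` and shifted by `−t` it is `P[3_k, 1_{k−t}, 1_{k−t}, apex]`, excluded by the top-three package (`k − t ≠ k`). -/
theorem z_absent (M : LineModel h vN vP) (hh : h < 12) {W : ACell} (hW : vP W) {a b c d : Fin 4} (hab : a ≠ b) (hac : a ≠ c)
    (had : a ≠ d) (hbc : b ≠ c) (hbd : b ≠ d) (hcd : c ≠ d) {k : Fin 4} (hWa : W a = (3, k)) (hWb : W b = (1, k))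
    (hWc : W c = (1, k)) (hWd : (W d).1 = 0) {t : Fin 4} (ht : t ≠ 0) {Z : ACell} (hZa : (Z a).1 = 0) (hZb : Z b = (1, k))
    (hZc : Z c = (1, k)) (hZd : Z d = (3, k + t)) : ¬ vP Z := by
  intro hZ
  have hS := M.shiftP_by (M.permP _ hZ (Equiv.swap a d)) (-t)
  have hT : vP (Function.update (Function.update W c (1, k + -t)) b (1, k + -t)) := by
    refine M.congrP hS (fun i => ?_)
    dsimp only
    rcases fin4_cover hab hac had hbc hbd hcd i with hi | hi | hi | hi <;> rw [hi]
    · left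
      rw [Equiv.swap_apply_left, hZd, Function.update_of_ne hab, Function.update_of_ne hac, hWa]
      exact Prod.ext rfl (fin4_add_add_neg k t)
    · left
      rw [Equiv.swap_apply_of_ne_of_ne hab.symm hbd, hZb, Function.update_self]
    · left
      rw [Equiv.swap_apply_of_ne_of_ne hac.symm hcd, hZc, Function.update_of_ne hbc.symm, Function.update_self]
    · right
      rw [Equiv.swap_apply_right, Function.update_of_ne hbd.symm, Function.update_of_ne hcd.symm]
      exact ⟨hZa, hWd⟩
  exact M.top3_package hh hW (g := a) (b := b) (c := c) hab hac hbc hWa (by rw [hWb]) hWc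
    (fin4_add_neg_ne_of_ne_zero k t ht) (k + -t) hT

end LineModel

end Summit.Ventures.HSemireg.Pad4Tower.LinePhaseRigidity
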